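import Summits.BirchSwinnertonDyer.BirchSwinnertonDyer.Theorems.PrintCf2SplitBadTwoETLocalInputs
import Summits.BirchSwinnertonDyer.BirchSwinnertonDyer.Theorems.PrintCf2SplitBadTwoETOfLocalInputs
import HarnessLib

/-!
# `hET_holds`: the hfin-FREE local brick (ET-v) on the road-α frame — `2 • res_{D_v}(e_* res_⊤ κ_n(Q)) = 0`

Crux `stmt-BirchSwinnertonDyer-20368` (`PrintCf2.SplitBadTwoRankOneOfFacts`), road α (skeleton v10.6), LEAD ruling (R-ET)
2026-08-29T00:38Z: «(ET-v) is PROVED, not displayed; -w3 g10 owns `hET_holds` (the hypothesis `hET` of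
`CMPrimes.cmScalar_localPoints_of_frame_of_etale`, p682736, VERBATIM)». Consumer: -w4 g10's (BF)
`finite_restrictedSelmerBase_of_finite_sha_of_frame` (the third factor (MW-v̄) through `cmScalar_localPoints_of_frame_of_etale ∘
hET_holds`), breaking the circularity «the branch `r`/`1 − r` at `v` was decided through `Finite 𝔖_{v̄}(K, W*)`».

THE PROOF (Greenberg LNM 1716 §2 + an order-`2` twist, no corestriction): on the frame (`C • W = cm7^{(d)}`, `d` squarefree,
`d ≢ 1 (4)`, `K` imaginary quadratic, `2 = v·v̄`, `π² = π − 2`, root `r` PINNED at `v`) take an inertia element `τ₀ ∈ I_{K_v}`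
negating `√d` (`exists_absInertia_sign_neg_of_frame`: for `d` even a Kummer element, for `d ≡ 3 (4)` an element of cyclotomic
character `−1`, -w2 g9's dyadic analysis); `c = τ₀|_{K̄}` acts on `W*` as `−1` ((L1), `smul_eq_neg_of_sign_neg`); for `σ ∈ D_v`
the commutator `j = c⁻¹σcσ⁻¹` is an inertia element fixing `√d`, so the Kummer value `jR − R` of a `2ⁿ`-th root `R` of `Q`
untwists into the kernel of reduction of the GOOD curve `cm7_K` (Silverman VIII §1) and therefore lies in `W*′ = ker e` ((L2),
`e_kummerCocycle_conj_eq_zero`, via the identification `T⁻¹(cm7_K,₁) ∩ E[2^∞] = W*′`); the cocycle identity then gives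
`f(σcσ⁻¹) = f(c)` for `f = e ∘ κ`, whence `2f` is a coboundary (`two_nsmul_resOfLe_kummer_eq_zero_of_localInputs`).
Main: `exists_absInertia_sign_neg_of_frame`, **`hET_holds`**. No definition, no named fact, no `sorry`.
BSD is not proved by any of this; no summit statement is proved by this file.

References: [GreenbergLNM1716] §2 Props. 2.1–2.4; [Rubin1999] §3 Lemma 3.6 (ii), Cor. 3.17; [Agboola2007] §6 Prop. 6.11;
[SilvermanAEC2009] VII.2.1, VIII §1, X.5 Cor. 5.4; [SerreGaloisCohomology1997] I.§5.1.
-/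

noncomputable section

open scoped Classical

set_option linter.dupNamespace false
set_option autoImplicit false

open NumberField IsDedekindDomain Field WeierstrassCurve
open Literature.NumberTheory.EllipticCurves Literature.NumberTheory.EllipticCurves.GreenbergSelmer
open Literature.NumberTheory.EllipticCurves.ResKernel
open Literature.NumberTheory.GaloisRepresentations

namespace Summit.BirchSwinnertonDyer.BirchSwinnertonDyer.Theorems.PrintCf2.CMPrimes

open Summit.BirchSwinnertonDyer.BirchSwinnertonDyer.Theorems.PrintCf2.AdditiveAtSeven
open Summit.BirchSwinnertonDyer.BirchSwinnertonDyer.Theorems.PrintCf2.ReductionTypesOverK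
open Summit.BirchSwinnertonDyer.BirchSwinnertonDyer.Theorems.PrintCf2.RestrictedSelmerPair
open Summit.BirchSwinnertonDyer.BirchSwinnertonDyer.Theorems.GenusKolyTwistRamified (exists_mem_absInertia_smul_geomSqrt_eq_neg)
open Summit.BirchSwinnertonDyer.BirchSwinnertonDyer.Theorems.PrintCf2

variable {K : Type} [Field K] [NumberField K]

/-- **An inertia element at `v` negating `√d`** on the road-α frame (`d` squarefree, `d ≢ 1 (mod 4)`, `K ∋ √−7` imaginary
quadratic, `2 = v·v̄`): for `d` even a Kummer element (`ord_v(d) = 1`, `e(v|2) = 1`), for `d ≡ 3 (mod 4)` an inertia element of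
cyclotomic character `−1` (it negates `√−1` and fixes `√−d`, `−d ≡ 1 (mod 4)`). This is the witness inside -w2 g9's
`natCard_fixedPoints_decomp_v_eq_two_of_frame` (p663559), exposed by name. [cite: NeukirchANT1999, Ch. II §7 and Ch. V (1.5)]
[cite: Rubin1999, §3 Lemma 3.6 (ii)] -/
theorem exists_absInertia_sign_neg_of_frame {d : ℤ} (hd0 : d ≠ 0) (hsq : Squarefree d) (hd4 : d % 4 ≠ 1)
    (W : WeierstrassCurve ℚ) [W.IsElliptic] (C : VariableChange ℚ) (hC : C • W = cm7.quadraticTwist (d : ℚ)) (hK : IsImaginaryQuadratic K)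
    {v vbar : HeightOneSpectrum (𝓞 K)} (hv : ((2 : ℕ) : 𝓞 K) ∈ v.asIdeal) (hvbar : ((2 : ℕ) : 𝓞 K) ∈ vbar.asIdeal) (hne : vbar ≠ v)
    (π : (W.baseChange K).endRing) (hrel : (π : AddMonoid.End (W.baseChange K).geomPoints) * π = π - 2) :
    ∃ τ₀ : absoluteGaloisGroup (v.adicCompletion K), τ₀ ∈ absInertia (v.adicCompletion K) ∧
      absGaloisRestrict K (v.adicCompletion K) τ₀ • absClosureEmbedding ℚ K (WeierstrassCurve.geomSqrt (d : ℚ)) =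
        -absClosureEmbedding ℚ K (WeierstrassCurve.geomSqrt (d : ℚ)) := by
  haveI : Fact (Nat.Prime 2) := ⟨Nat.prime_two⟩
  have hj : W.j = -3375 := j_eq_of_smul_eq_cm7Twist hd0 W C hC
  obtain ⟨θ, hθ⟩ := exists_sq_eq_neg_seven_of_cmEndo_mem_endRing W K hj π hrel
  have hK2 : Module.finrank ℚ K = 2 := hK.1
  by_cases h2d : 2 ∣ d
  · -- `d` even: a Kummer inertia element negating `√d`
    obtain ⟨d', rfl⟩ := h2d
    have hd' : ¬ (2 : ℤ) ∣ d' := by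
      rintro ⟨k, rfl⟩
      have h := hsq 2 ⟨k, by ring⟩
      rw [Int.isUnit_iff] at h; omega
    set u := v.under (𝓞 ℚ) with hu
    have h2u : ((2 : ℕ) : 𝓞 ℚ) ∈ u.asIdeal := by
      change algebraMap (𝓞 ℚ) (𝓞 K) ((2 : ℕ) : 𝓞 ℚ) ∈ v.asIdeal
      rwa [map_natCast]
    have hgen2 : Rat.HeightOneSpectrum.natGenerator u = 2 :=
      (Nat.prime_dvd_prime_iff_eq (Rat.HeightOneSpectrum.prime_natGenerator u) Nat.prime_two).mp ((Rat.natCast_mem_asIdeal_iff _).mp h2u)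
    have he1 : v.asIdeal.ramificationIdx (𝓞 ℚ) = 1 := ramificationIdx_eq_one_of_frame K v hK hθ hd0 W hC (by rw [← hu, hgen2]; norm_num)
    have hval : v.valuation K (((2 * d' : ℤ)) : K) = WithZero.exp (-1 : ℤ) := by
      have hnd : ¬ ((Rat.HeightOneSpectrum.natGenerator u : ℕ) : ℤ) ∣ d' := by rw [hgen2]; exact hd'
      have h := Rat.valuation_pow_mul_intCast u hnd 1
      rw [hgen2, pow_one] at h
      rw [show (((2 * d' : ℤ)) : K) = algebraMap ℚ K ((((2 : ℕ) : ℚ) * ((d' : ℤ) : ℚ))) by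
          rw [map_mul, map_natCast, map_intCast]; push_cast; ring,
        valuation_algebraMap_eq_pow_ramificationIdx K v, he1, pow_one, ← hu]
      exact_mod_cast h
    obtain ⟨τ, hτI, hτB⟩ := exists_mem_absInertia_smul_geomSqrt_eq_neg (K := K) v (d := ((2 * d' : ℤ) : K))
      (by exact_mod_cast hd0) ⟨_, 1, hval, by ring⟩
    exact ⟨τ, hτI, by exact_mod_cast smul_absClosureEmbedding_geomSqrt_of_smul_geomSqrt K (d := 2 * d') _ hτB⟩
  · -- `d ≡ 3 (mod 4)`: an inertia element with cyclotomic character `−1`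
    have hd3 : (-d) % 4 = 1 := by omega
    have hum1 : IsUnit ((-1 : ℤ) : ℤ_[2]) := by rw [Int.cast_neg, Int.cast_one]; exact isUnit_one.neg
    obtain ⟨τ, hτI, hτχ⟩ := ZpExtension.exists_mem_inertia_cyclotomicCharacter_eq_of_split hK2 hvbar hv hne.symm
      (adicCompletionPrime_mem_primesAbove K v) hum1.unit
    rw [inertia_adicCompletionPrime_eq_map_absInertia K v, Subgroup.mem_map] at hτI
    obtain ⟨σ, hσI, hστ⟩ := hτI
    have hε : ((GaloisRep.cyclotomicCharacter K 2 (absGaloisRestrict K (v.adicCompletion K) σ) : ℤ_[2]ˣ) : ℤ_[2]) = -1 := by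
      have := congrArg (fun u : ℤ_[2]ˣ ↦ (u : ℤ_[2])) hτχ
      simp only [IsUnit.unit_spec, Int.cast_neg, Int.cast_one] at this
      rw [← this]
      exact congrArg (fun g ↦ ((GaloisRep.cyclotomicCharacter K 2 g : ℤ_[2]ˣ) : ℤ_[2])) hστ
    have hZ := smul_geomSqrt_neg_one_eq_neg_of_cyclotomicCharacter K _ hε
    have hB := smul_geomSqrt_eq_of_mem_absInertia_of_emod_four_eq_one v hv hd3 hσI
    rcases smul_absClosureEmbedding_geomSqrt_eq_or K (d : ℚ) (absGaloisRestrict K (v.adicCompletion K) σ) with hA | hA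
    · have hse := sign_mul_eq_of_smul_geomSqrt K hd0 _ (s := 1) (e := -1) (Or.inl ⟨hA, rfl⟩) (Or.inr ⟨hZ, rfl⟩) (Or.inl ⟨hB, rfl⟩)
      norm_num at hse
    · exact ⟨σ, hσI, hA⟩

/-- **`hET_holds` — the hfin-FREE local brick (ET-v), i.e. the hypothesis `hET` of `cmScalar_localPoints_of_frame_of_etale`
VERBATIM, proved on the road-α frame at the pinned place `v`:** for every additive `Γ_K`-equivariant map
`e : E[2^∞] → W* = E[𝔮_r^∞]` which is the identity on `W*` and kills `W*′ = E[𝔮_{1−r}^∞]`, every `Q ∈ E(K)` and every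
level `n`, `2 • res_{⊤ ⊓ D_v}(e_* res_⊤ κ_n(Q)) = 0`. Hypotheses: `d ≠ 0` squarefree with `d % 4 ≠ 1`, `C • W = cm7^{(d)}`,
`K` imaginary quadratic, `v̄ ≠ v` above `2`, `π² = π − 2`, `r² = r − 2`, and the PINNING clause at `v` (inertia acts on `W*`
through `±1`) — all carried by the S3b′/S3c frames of skeleton v10.6; NO `Finite 𝔖`, NO `Finite Ш`.
[cite: GreenbergLNM1716, §2 Props. 2.1–2.4] [cite: Rubin1999, §3 Lemma 3.6 (ii) and Cor. 3.17] [cite: Agboola2007, §6 Prop. 6.11] -/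
theorem hET_holds {d : ℤ} (hd0 : d ≠ 0) (hsq : Squarefree d) (hd4 : d % 4 ≠ 1)
    (W : WeierstrassCurve ℚ) [W.IsElliptic] (C : VariableChange ℚ) (hCW : C • W = cm7.quadraticTwist (d : ℚ))
    (hK : IsImaginaryQuadratic K) (v vbar : HeightOneSpectrum (𝓞 K)) (hv : ((2 : ℕ) : 𝓞 K) ∈ v.asIdeal)
    (hvbar : ((2 : ℕ) : 𝓞 K) ∈ vbar.asIdeal) (hne : vbar ≠ v)
    (π : (W.baseChange K).endRing) (hrel : (π : AddMonoid.End (W.baseChange K).geomPoints) * π = π - 2)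
    {r : ℤ_[2]} (hr : r * r = r - 2)
    (hpin : ∀ τ ∈ GreenbergSelmer.inertia v, ∀ x : ↥((W.baseChange K).endEigenPrimaryTorsion 2 π r), τ • x = x ∨ τ • x = -x) :
    haveI : Fact (Nat.Prime 2) := ⟨Nat.prime_two⟩
    ∀ (e : (W.baseChange K).geomPrimaryTorsion 2 →+ ↥((W.baseChange K).endEigenPrimaryTorsion 2 π r))
      (_he₁ : ∀ x : ↥((W.baseChange K).endEigenPrimaryTorsion 2 π r), e x = x)
      (_he0 : ∀ x ∈ (W.baseChange K).endEigenPrimaryTorsion 2 π (1 - r), e x = 0)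
      (he : ∀ (σ : absoluteGaloisGroup K) (x : (W.baseChange K).geomPrimaryTorsion 2), e (σ • x) = σ • e x)
      (Q : (W.baseChange K).toAffine.Point) (n : ℕ),
      2 • resOfLe ↥((W.baseChange K).endEigenPrimaryTorsion 2 π r) (inf_le_left : ⊤ ⊓ decomp v ≤ ⊤)
        (resH1Hom (ContinuousMonoidHom.id (⊤ : Subgroup (absoluteGaloisGroup K))) e (fun σ x ↦ he σ x)
          (resSubgroup ⊤ ((W.baseChange K).geomPrimaryTorsion 2)
            ((W.baseChange K).kummerMapLevel 2 (W.baseChange K).zsmul_geomPoints_surjective_holds n Q))) = 0 := by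
  haveI : Fact (Nat.Prime 2) := ⟨Nat.prime_two⟩
  intro e _ he0 he Q n
  obtain ⟨τ₀, hτ₀, hsign⟩ := exists_absInertia_sign_neg_of_frame hd0 hsq hd4 W C hCW hK hv hvbar hne π hrel
  have hcD : absGaloisRestrict K (v.adicCompletion K) τ₀ ∈ (⊤ ⊓ decomp v : Subgroup (absoluteGaloisGroup K)) :=
    Subgroup.mem_inf.2 ⟨Subgroup.mem_top _, (mem_decomp_iff v _).2 ⟨τ₀, rfl⟩⟩
  exact two_nsmul_resOfLe_kummer_eq_zero_of_localInputs (W.baseChange K) π r v e he _ hcD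
    (smul_eq_neg_of_sign_neg hd0 W C hCW hK hv hvbar hne π hrel hr hpin hτ₀ hsign) Q n
    (fun σ hσ ↦ e_kummerCocycle_conj_eq_zero hd0 W C hCW hK hv hvbar hne π hrel hr hpin hτ₀ e he0 hσ n _ _)

end Summit.BirchSwinnertonDyer.BirchSwinnertonDyer.Theorems.PrintCf2.CMPrimes

end
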